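import Literature.Probability.LatticeModels.TemperleyLiebCapContract
import HarnessLib

/-!
# Naturality of cap insertion and contraction under the far generators; the cap absorbs its own generator («TL-CAP-NATURALITY»)

Topic `Literature/Probability/LatticeModels`; a rider on `TemperleyLiebCapContract.lean` («TL-CAP-CONTRACT»: `skip`, `capIns`, `contractSucc`, `capInsL`, `contractL`,
`e_j = capInsL j ∘ contractL j` at loop weight `1`). The relations that make the planar modules `V_n ↪ V_{n+2}` a tower of representations of the «far» Temperley–Lieb
generators (Pearce–Rittenberg–de Gier–Nienhuis's diagram calculus: a generator acting away from a cap slides past it):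

* `LinkPattern.connectSucc_capIns_self` — the move at `j` fixes every pattern with the cap `{j, j+1}`; ★ `tlL_one_capInsL` — **`e_j ∘ cap_j = cap_j`** (`δ = 1`); `contractSucc_connectSucc_self`
  / ★ `contractL_tlL_one` — **`contract_j ∘ e_j = contract_j`**;
* ★★ `LinkPattern.capIns_connectSucc_of_lt` / `_of_le` — **NATURALITY OF THE CAP**: a move at sites `i, i+1` BELOW `j` (resp. FROM `j` ON) of a pattern `P` becomes, after
  inserting the cap at `j`, the move at `i, i+1` (resp. `i+2, i+3`): `(capIns j P) · e_{i'} = capIns j (P · e_i)`; linear forms ★★ `tlL_one_capInsL_of_lt` / `_of_le`;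
* `LinkPattern.capIns_injective`; ★★ `contractSucc_connectSucc_of_lt` / `_of_le` and `contractL_tlL_one_of_lt` / `_of_le` — **NATURALITY OF THE CONTRACTION** (from the cap's, by
  injectivity of `capIns` and far commutation of the moves, `connect_comm_of_disjoint`).

Use (lane): these are the bookkeeping identities behind the hexagon-tower calculus for boundary laws (HOME `FINDING-BSPAN-TOWER-IDENTITY.md` §4: `e_j` acts as the identity
on vectors with a cap at `j`; inductions on the number of marked points move generators across `capInsL`).

## References
* P. A. Pearce, V. Rittenberg, J. de Gier, B. Nienhuis, *Temperley–Lieb stochastic processes*, J. Phys. A 35 (2002) L661–L668, §2 ((TL), (monoid): the diagram calculus;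
  `[e_i, e_j] = 0` for `|i − j| > 1`, `e_j² = (q + q⁻¹) e_j`).

## Mathlib / tree
Tree: `TemperleyLiebCapContract.lean` (`skip`, `skip_val`, `skip_injective`, `skip_ne_castSucc/succ`, `unskip`, `skip_unskip`, `capIns_partner_castSucc/succ/skip`,
`LinkPattern.capIns`, `contractSucc`, `capIns_contractSucc`, `contractSucc_capIns`, `capInsL_single`, `contractL_single`, `tlL_one_single`), `TemperleyLiebLinkModule.lean`
(`connectSucc`, `connectSucc_val`, `connectSucc_of_partner_eq`), `TemperleyLiebLinkRelations.lean` (`connect_partner_partner_left/right`, `connect_partner_of_ne`,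
`connect_comm_of_disjoint`), `TemperleyLiebLinkPatterns.lean` (`connect_partner_left/right`, `connect_connect`). Mathlib: `Finsupp.lhom_ext`.
-/

namespace Literature.Probability.LatticeModels.TemperleyLieb

open Function

/-! ### The cap absorbs its own generator -/

section Absorb

variable {R : Type*} [CommRing R] {n : ℕ}

/-- the move at `j` fixes a pattern carrying the cap `{j, j+1}`. [cite: PearceRittenbergDeGierNienhuis2002, §2 (monoid: a closed loop is erased)] -/
theorem LinkPattern.connectSucc_capIns_self (j : Fin (n + 1)) (P : LinkPattern n) : (P.capIns j).connectSucc j = P.capIns j :=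
  LinkPattern.connectSucc_of_partner_eq _ (PerfectMatching.capIns_partner_castSucc j P.1)

/-- ★ **`e_j ∘ cap_j = cap_j` at loop weight `1`.** [cite: PearceRittenbergDeGierNienhuis2002, §2 ((TL) with `q + q⁻¹ = 1`)] -/
theorem tlL_one_capInsL (j : Fin (n + 1)) (x : LinkPattern n →₀ R) : tlL R 1 j (capInsL R j x) = capInsL R j x := by
  have h : tlL R (1 : R) j ∘ₗ capInsL R j = capInsL R j := by
    refine Finsupp.lhom_ext fun P c => ?_
    rw [LinearMap.comp_apply, capInsL_single, tlL_one_single, LinkPattern.connectSucc_capIns_self]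
  exact LinearMap.congr_fun h x

/-- the move at `j` twice is the move once. [cite: PearceRittenbergDeGierNienhuis2002, §2 (TL)] -/
theorem LinkPattern.connectSucc_connectSucc_self (j : Fin (n + 1)) (Q : LinkPattern (n + 1 + 1)) : (Q.connectSucc j).connectSucc j = Q.connectSucc j :=
  Subtype.ext (PerfectMatching.connect_connect Q.1 _ _)

/-- contracting after the move at `j` is contracting. [cite: PearceRittenbergDeGierNienhuis2002, §2 (monoid)] -/
theorem LinkPattern.contractSucc_connectSucc_self (j : Fin (n + 1)) (Q : LinkPattern (n + 1 + 1)) : (Q.connectSucc j).contractSucc j = Q.contractSucc j := by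
  unfold LinkPattern.contractSucc
  exact Subtype.ext (PerfectMatching.contract_congr j (congrArg Subtype.val (Q.connectSucc_connectSucc_self j))
    ((Q.connectSucc j).connectSucc_partner_castSucc j) (Q.connectSucc_partner_castSucc j))

/-- ★ **`contract_j ∘ e_j = contract_j` at loop weight `1`.** [cite: PearceRittenbergDeGierNienhuis2002, §2 (monoid)] -/
theorem contractL_tlL_one (j : Fin (n + 1)) (x : LinkPattern (n + 1 + 1) →₀ R) : contractL R j (tlL R 1 j x) = contractL R j x := by
  have h : contractL R j ∘ₗ tlL R (1 : R) j = contractL R j := by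
    refine Finsupp.lhom_ext fun Q c => ?_
    rw [LinearMap.comp_apply, tlL_one_single, contractL_single, contractL_single, LinkPattern.contractSucc_connectSucc_self]
  exact LinearMap.congr_fun h x

end Absorb

/-! ### Naturality of the cap under the far moves -/

section Naturality

variable {n : ℕ}

/-- the core computation: the move at sites `a' = skip j a`, `b' = skip j b` of `capIns j p` is `capIns j` of the move at `a, b` (for any two sites `a ≠ b`).
[cite: PearceRittenbergDeGierNienhuis2002, §2 (monoid: the diagram calculus)] -/
theorem PerfectMatching.capIns_connect (j : Fin (n + 1)) (p : PerfectMatching n) {a b : Fin n} (hab : a ≠ b) :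
    (PerfectMatching.capIns j p).connect (skip j a) (skip j b) = PerfectMatching.capIns j (p.connect a b) := by
  set q := PerfectMatching.capIns j p with hq
  have hab' : skip j a ≠ skip j b := fun e => hab (skip_injective j e)
  have hqa : q.partner (skip j a) = skip j (p.partner a) := PerfectMatching.capIns_partner_skip j p a
  have hqb : q.partner (skip j b) = skip j (p.partner b) := PerfectMatching.capIns_partner_skip j p b
  apply PerfectMatching.ext
  funext x
  by_cases h1 : x = Fin.castSucc j
  · subst h1
    rw [PerfectMatching.capIns_partner_castSucc,
      PerfectMatching.connect_partner_of_ne _ (skip_ne_castSucc j a).symm (skip_ne_castSucc j b).symm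
        (by rw [hqa]; exact (skip_ne_castSucc j _).symm) (by rw [hqb]; exact (skip_ne_castSucc j _).symm),
      PerfectMatching.capIns_partner_castSucc]
  by_cases h2 : x = j.succ
  · subst h2
    rw [PerfectMatching.capIns_partner_succ,
      PerfectMatching.connect_partner_of_ne _ (skip_ne_succ j a).symm (skip_ne_succ j b).symm
        (by rw [hqa]; exact (skip_ne_succ j _).symm) (by rw [hqb]; exact (skip_ne_succ j _).symm),
      PerfectMatching.capIns_partner_succ]
  obtain ⟨y, rfl⟩ : ∃ y, skip j y = x := ⟨unskip j x h1 h2, skip_unskip j x h1 h2⟩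
  rw [PerfectMatching.capIns_partner_skip]
  -- now a case analysis on `y` against `a, b, p a, p b`
  by_cases hya : y = a
  · subst hya; rw [PerfectMatching.connect_partner_left _ hab', PerfectMatching.connect_partner_left _ hab]
  by_cases hyb : y = b
  · subst hyb; rw [PerfectMatching.connect_partner_right _ hab', PerfectMatching.connect_partner_right _ hab]
  by_cases hypa : y = p.partner a
  · subst hypa; rw [← hqa, PerfectMatching.connect_partner_partner_left _ hab', PerfectMatching.connect_partner_partner_left _ hab, hqb]
  by_cases hypb : y = p.partner b
  · subst hypb; rw [← hqb, PerfectMatching.connect_partner_partner_right _ hab', PerfectMatching.connect_partner_partner_right _ hab, hqa]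
  rw [PerfectMatching.connect_partner_of_ne _ (fun e => hya (skip_injective j e)) (fun e => hyb (skip_injective j e))
      (by rw [hqa]; exact fun e => hypa (skip_injective j e)) (by rw [hqb]; exact fun e => hypb (skip_injective j e)),
    PerfectMatching.connect_partner_of_ne _ hya hyb hypa hypb, PerfectMatching.capIns_partner_skip]

/-- ★★ **NATURALITY OF THE CAP, below the cap**: for `i + 1 < j` the move at `i, i+1` commutes with inserting the cap at `j`: `(capIns j P) · e_i = capIns j (P · e_i)`.
[cite: PearceRittenbergDeGierNienhuis2002, §2 ((TL): `[e_i, e_j] = 0` for `|i − j| > 1`; (monoid))] -/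
theorem LinkPattern.capIns_connectSucc_of_lt (j : Fin (n + 1 + 1 + 1)) (P : LinkPattern (n + 1 + 1)) (i : Fin (n + 1)) (i' : Fin (n + 1 + 1 + 1))
    (h : i.val + 1 < j.val) (hi' : i'.val = i.val) : (P.capIns j).connectSucc i' = (P.connectSucc i).capIns j := by
  have e1 : Fin.castSucc i' = skip j (Fin.castSucc i) := Fin.ext (by rw [Fin.val_castSucc, skip_val, Fin.val_castSucc, if_pos (by omega), hi'])
  have e2 : i'.succ = skip j i.succ := Fin.ext (by rw [Fin.val_succ, skip_val, Fin.val_succ, if_pos (by omega), hi'])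
  apply Subtype.ext
  rw [LinkPattern.connectSucc_val, e1, e2]
  exact PerfectMatching.capIns_connect j P.1 (show Fin.castSucc i < i.succ from Fin.castSucc_lt_succ).ne

/-- ★★ **NATURALITY OF THE CAP, above the cap**: for `j ≤ i` the move at `i, i+1` of `P` becomes the move at `i+2, i+3` after inserting the cap at `j`.
[cite: PearceRittenbergDeGierNienhuis2002, §2 ((TL): `[e_i, e_j] = 0` for `|i − j| > 1`; (monoid))] -/
theorem LinkPattern.capIns_connectSucc_of_le (j : Fin (n + 1 + 1 + 1)) (P : LinkPattern (n + 1 + 1)) (i : Fin (n + 1)) (i' : Fin (n + 1 + 1 + 1))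
    (h : j.val ≤ i.val) (hi' : i'.val = i.val + 2) : (P.capIns j).connectSucc i' = (P.connectSucc i).capIns j := by
  have e1 : Fin.castSucc i' = skip j (Fin.castSucc i) := Fin.ext (by rw [Fin.val_castSucc, skip_val, Fin.val_castSucc, if_neg (by omega), hi'])
  have e2 : i'.succ = skip j i.succ := Fin.ext (by rw [Fin.val_succ, skip_val, Fin.val_succ, if_neg (by omega), hi'])
  apply Subtype.ext
  rw [LinkPattern.connectSucc_val, e1, e2]
  exact PerfectMatching.capIns_connect j P.1 (show Fin.castSucc i < i.succ from Fin.castSucc_lt_succ).ne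

variable {R : Type*} [CommRing R]

/-- ★★ linear form, below: `e_{i'} ∘ capInsL j = capInsL j ∘ e_i` (`i' = i`, `i + 1 < j`, loop weight `1`). [cite: PearceRittenbergDeGierNienhuis2002, §2 (TL)] -/
theorem tlL_one_capInsL_of_lt (j : Fin (n + 1 + 1 + 1)) (i : Fin (n + 1)) (i' : Fin (n + 1 + 1 + 1)) (h : i.val + 1 < j.val) (hi' : i'.val = i.val)
    (x : LinkPattern (n + 1 + 1) →₀ R) : tlL R 1 i' (capInsL R j x) = capInsL R j (tlL R 1 i x) := by
  have key : tlL R (1 : R) i' ∘ₗ capInsL R j = capInsL R j ∘ₗ tlL R (1 : R) i := by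
    refine Finsupp.lhom_ext fun P c => ?_
    rw [LinearMap.comp_apply, LinearMap.comp_apply, capInsL_single, tlL_one_single, tlL_one_single, capInsL_single, LinkPattern.capIns_connectSucc_of_lt j P i i' h hi']
  exact LinearMap.congr_fun key x

/-- ★★ linear form, above: `e_{i'} ∘ capInsL j = capInsL j ∘ e_i` (`i' = i + 2`, `j ≤ i`, loop weight `1`). [cite: PearceRittenbergDeGierNienhuis2002, §2 (TL)] -/
theorem tlL_one_capInsL_of_le (j : Fin (n + 1 + 1 + 1)) (i : Fin (n + 1)) (i' : Fin (n + 1 + 1 + 1)) (h : j.val ≤ i.val) (hi' : i'.val = i.val + 2)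
    (x : LinkPattern (n + 1 + 1) →₀ R) : tlL R 1 i' (capInsL R j x) = capInsL R j (tlL R 1 i x) := by
  have key : tlL R (1 : R) i' ∘ₗ capInsL R j = capInsL R j ∘ₗ tlL R (1 : R) i := by
    refine Finsupp.lhom_ext fun P c => ?_
    rw [LinearMap.comp_apply, LinearMap.comp_apply, capInsL_single, tlL_one_single, tlL_one_single, capInsL_single, LinkPattern.capIns_connectSucc_of_le j P i i' h hi']
  exact LinearMap.congr_fun key x

end Naturality

/-! ### Naturality of the contraction -/

section ContractNaturality

variable {n : ℕ}

/-- cap insertion is injective. [cite: PearceRittenbergDeGierNienhuis2002, §2] -/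
theorem LinkPattern.capIns_injective (j : Fin (n + 1)) : Injective (LinkPattern.capIns (n := n) j) := by
  intro P P' e
  rw [← LinkPattern.contractSucc_capIns j P, ← LinkPattern.contractSucc_capIns j P', e]

/-- far moves commute on link patterns. [cite: PearceRittenbergDeGierNienhuis2002, §2 ((TL): `[e_i, e_j] = 0` for `|i − j| > 1`)] -/
theorem LinkPattern.connectSucc_comm_of_far (Q : LinkPattern (n + 1 + 1)) (i j : Fin (n + 1)) (h : i.val + 1 < j.val ∨ j.val + 1 < i.val) :
    (Q.connectSucc i).connectSucc j = (Q.connectSucc j).connectSucc i := by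
  apply Subtype.ext
  rw [LinkPattern.connectSucc_val, LinkPattern.connectSucc_val, LinkPattern.connectSucc_val, LinkPattern.connectSucc_val]
  refine PerfectMatching.connect_comm_of_disjoint Q.1 ?_ ?_ ?_ ?_ <;>
    · intro e; have := congrArg Fin.val e; simp only [Fin.val_castSucc, Fin.val_succ] at this; omega

/-- ★★ **NATURALITY OF THE CONTRACTION, below the cap**: `contractSucc j (Q · e_{i'}) = (contractSucc j Q) · e_i` for `i + 1 < j`, `i' = i`.
[cite: PearceRittenbergDeGierNienhuis2002, §2 ((TL), (monoid))] -/
theorem LinkPattern.contractSucc_connectSucc_of_lt (j : Fin (n + 1 + 1 + 1)) (Q : LinkPattern (n + 1 + 1 + 1 + 1)) (i : Fin (n + 1)) (i' : Fin (n + 1 + 1 + 1))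
    (h : i.val + 1 < j.val) (hi' : i'.val = i.val) : (Q.connectSucc i').contractSucc j = (Q.contractSucc j).connectSucc i := by
  apply LinkPattern.capIns_injective j
  rw [LinkPattern.capIns_contractSucc, ← LinkPattern.capIns_connectSucc_of_lt j _ i i' h hi', LinkPattern.capIns_contractSucc]
  exact LinkPattern.connectSucc_comm_of_far Q i' j (Or.inl (by omega))

/-- ★★ **NATURALITY OF THE CONTRACTION, above the cap**: `contractSucc j (Q · e_{i'}) = (contractSucc j Q) · e_i` for `j ≤ i`, `i' = i + 2`.
[cite: PearceRittenbergDeGierNienhuis2002, §2 ((TL), (monoid))] -/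
theorem LinkPattern.contractSucc_connectSucc_of_le (j : Fin (n + 1 + 1 + 1)) (Q : LinkPattern (n + 1 + 1 + 1 + 1)) (i : Fin (n + 1)) (i' : Fin (n + 1 + 1 + 1))
    (h : j.val ≤ i.val) (hi' : i'.val = i.val + 2) : (Q.connectSucc i').contractSucc j = (Q.contractSucc j).connectSucc i := by
  apply LinkPattern.capIns_injective j
  rw [LinkPattern.capIns_contractSucc, ← LinkPattern.capIns_connectSucc_of_le j _ i i' h hi', LinkPattern.capIns_contractSucc]
  exact LinkPattern.connectSucc_comm_of_far Q i' j (Or.inr (by omega))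

variable {R : Type*} [CommRing R]

/-- ★★ linear form, below: `contractL j ∘ e_{i'} = e_i ∘ contractL j` (`i' = i`, `i + 1 < j`, loop weight `1`). [cite: PearceRittenbergDeGierNienhuis2002, §2 (TL)] -/
theorem contractL_tlL_one_of_lt (j : Fin (n + 1 + 1 + 1)) (i : Fin (n + 1)) (i' : Fin (n + 1 + 1 + 1)) (h : i.val + 1 < j.val) (hi' : i'.val = i.val)
    (x : LinkPattern (n + 1 + 1 + 1 + 1) →₀ R) : contractL R j (tlL R 1 i' x) = tlL R 1 i (contractL R j x) := by
  have key : contractL R j ∘ₗ tlL R (1 : R) i' = tlL R (1 : R) i ∘ₗ contractL R j := by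
    refine Finsupp.lhom_ext fun Q c => ?_
    rw [LinearMap.comp_apply, LinearMap.comp_apply, tlL_one_single, contractL_single, contractL_single, tlL_one_single,
      LinkPattern.contractSucc_connectSucc_of_lt j Q i i' h hi']
  exact LinearMap.congr_fun key x

/-- ★★ linear form, above: `contractL j ∘ e_{i'} = e_i ∘ contractL j` (`i' = i + 2`, `j ≤ i`, loop weight `1`). [cite: PearceRittenbergDeGierNienhuis2002, §2 (TL)] -/
theorem contractL_tlL_one_of_le (j : Fin (n + 1 + 1 + 1)) (i : Fin (n + 1)) (i' : Fin (n + 1 + 1 + 1)) (h : j.val ≤ i.val) (hi' : i'.val = i.val + 2)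
    (x : LinkPattern (n + 1 + 1 + 1 + 1) →₀ R) : contractL R j (tlL R 1 i' x) = tlL R 1 i (contractL R j x) := by
  have key : contractL R j ∘ₗ tlL R (1 : R) i' = tlL R (1 : R) i ∘ₗ contractL R j := by
    refine Finsupp.lhom_ext fun Q c => ?_
    rw [LinearMap.comp_apply, LinearMap.comp_apply, tlL_one_single, contractL_single, contractL_single, tlL_one_single,
      LinkPattern.contractSucc_connectSucc_of_le j Q i i' h hi']
  exact LinearMap.congr_fun key x

end ContractNaturality

end Literature.Probability.LatticeModels.TemperleyLieb
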